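import Summits.Ventures.CertifiedArithmetic.LowPrec.GemmThetaLawGenDefs

/-!
# The E2M3×E2M1 mixed all-precision law as `LawData`; levels `Q` and `top` checked

HONEST FRAMING (venture CertifiedArithmetic / cell `pub-lowprec`, seat gemm, gen 12 → 13): certified
error envelopes and provably optimal rounding/accumulation schemes for low-precision formats under
stated cost models; every table by two implementations; no hardware or vendor claims.

`e2m3e2m1Law` is the product alphabet E2M3 × E2M1 (grid `2^-4`, 165 signed letters, `x_max = 720`)
with the first mixed law of paper `gemm.tex` Theorem t:thetapmix in the symbolic regime `M = 256K`,
`K ≥ 2`, i.e. EVERY `p ≥ 10`.  The check `LawData.lawCheck` (14,014 classes, the design aid's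
count) is split by level over this file (`Q`, `top`, side conditions) and
`GemmThetaLawGenMixACheck1..5.lean` (binades 0…9); `GemmThetaLawGenMixA.lean` assembles
`lawCheck_e2m3e2m1`.  Executable half of the certificate; the soundness layer is gen 13's.
-/

namespace Literature.ComputerArithmetic.FloatingPoint

namespace MiniFloat

namespace ThetaLaw

/-- E2M3 × E2M1 products (grid `2^-4`) with the law of gemm.tex Thm t:thetapmix (first mixed row):
`B = (2,3,4,5,6,8,9,11,15,23)`, `S = (2,2,2,2,4,2,4,8,16,32)`, `J = 9`, `θ = (23M + 32)/480 =
(23·2^(p-6) + 1)/15`, `κ = 256/(15M + 16)`, `ρ = 31/2`, `β_pair = 95/2`; symbolic regime `M = 256K`,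
`K ≥ 2` (every `p ≥ 10`, which is also the regime floor `2M > x_max = 720`). [cell, laws.py] -/
def e2m3e2m1Law : LawData :=
  { X := [
      1, 2, 3, 4, 5, 6, 7, 8, 9, 10, 11, 12, 13, 14, 15, 16, 18, 20, 21, 22, 24, 26, 27, 28, 30,
      32, 33, 36, 39, 40, 42, 44, 45, 48, 52, 54, 56, 60, 64, 66, 72, 78, 80, 84, 88, 90, 96,
      104, 108, 112, 120, 128, 132, 144, 156, 160, 168, 176, 180, 192, 208, 216, 224, 240, 256,
      264, 288, 312, 320, 336, 352, 360, 384, 416, 432, 448, 480, 528, 576, 624, 672, 720],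
    J := 9, B := [2, 3, 4, 5, 6, 8, 9, 11, 15, 23], S := [2, 2, 2, 2, 4, 2, 4, 8, 16, 32],
    th1 := 23, th0 := 32, thD := 480, kb := 8, rhoN := 31, rhoD := 2, betaN := 95, betaD := 2,
    M0 := 256, K0 := 2, fixed := false }

/-- Side conditions of the E2M3×E2M1 regime. [cell, kernel] -/
theorem sideOK_e2m3e2m1 : e2m3e2m1Law.sideOK = true := by
  decide +kernel

/-- Level `Q` of the E2M3×E2M1 law check passes (1630 classes, both signs, all 165 letters).
[cell, kernel `decide`] -/
theorem levCheck_e2m3e2m1_Q : e2m3e2m1Law.levCheck (Lev.Q) = true := by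
  decide +kernel

/-- Level `top` of the E2M3×E2M1 law check passes (330 classes, both signs, all 165 letters).
[cell, kernel `decide`] -/
theorem levCheck_e2m3e2m1_top : e2m3e2m1Law.levCheck (Lev.top) = true := by
  decide +kernel

end ThetaLaw

end MiniFloat

end Literature.ComputerArithmetic.FloatingPoint
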